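import Summits.QuantumFields.YangMills.Theses.FradkinShenkerFlow
import Literature.MathematicalPhysics.QuantumFieldTheory.LatticeGaugeProofs

/-!
# Definitions for the proof of `PoincareToClustering` (route `FradkinShenkerFlow`, `YangMills`)

Support item `stmt-QuantumFields-9444`
(`Summit.QuantumFields.YangMills.Theses.FradkinShenkerFlow.PoincareToClustering`, UP ⇒ EC).
The proof runs the random-scan single-link heat-bath (Glauber) sampler of the torus Wilson
measure `wilsonMeasure ρ β` in DISCRETE time; this file only fixes the objects (no claims):

* `linkNbhd ℓ` — the links the heat-bath law of `ℓ` may read (all links based at a site of the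
  shadow of `{ℓ}` or at a forward neighbour of such a site; volume-independent size);
* `bw ρ β U = exp(-β S_W(U))` — the Boltzmann weight;
* `hbLaw ρ β ℓ U = Haar.tilted (g' ↦ -β S_W(U[ℓ ↦ g']))` — the one-link heat-bath law, VERBATIM
  the law in the route's uniform Poincaré hypothesis; `hbOp ρ β ℓ h U = ∫ h(U[ℓ ↦ g]) dhbLaw` —
  the heat-bath operator `E_ℓ`;
* `scanOp ρ β h = |E|⁻¹ ∑_ℓ E_ℓ h` — the random-scan heat-bath operator `K`, and its iterates
  `scanIter ρ β j h = K^j h`;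
* `tdist c ℓ` — cyclic distance of the time coordinate of `ℓ` from the slice `c ∈ ℤ/L`;
* `osc h ℓ = sup_{U,g} |h(U[ℓ ↦ g]) − h(U)|` — the oscillation of `h` along `ℓ`.

References: F. Martinelli, *Lectures on Glauber dynamics for discrete spin models*, LNM 1717
(1999), §2–3; T. Liggett, *Interacting Particle Systems* (2005), Ch. I.
-/

noncomputable section

open MeasureTheory ProbabilityTheory
open Literature.MathematicalPhysics.QuantumFieldTheory

namespace Summit.QuantumFields.YangMills.Theorems.PoincareClustering

section Geometry

variable {d L : ℕ}

/-- The **link neighbourhood** of `ℓ`: all links based at a site of the shadow of `{ℓ}` (the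
base point of `ℓ` and its backward neighbours) or at a forward neighbour of such a site. It
contains every link of every plaquette containing `ℓ`; its size is at most `(d+1)(d+d²)`,
uniformly in the volume. [folklore] -/
def linkNbhd (ℓ : Edge d L) : Finset (Edge d L) :=
  (edgeShadow ({ℓ} : Finset (Edge d L))).biUnion fun y =>
    (Finset.univ.image fun i : Fin d => (y, i)) ∪
      (Finset.univ.image fun p : Fin d × Fin d => (y.shift p.1, p.2))

/-- The **cyclic time distance** of the link `ℓ` from the time slice `c ∈ ℤ/L`: the cyclic
distance `|ℓ.1 0 − c|` around `ℤ/L` (`ZMod.valMinAbs`). [folklore] -/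
def tdist [NeZero d] (c : ZMod L) (ℓ : Edge d L) : ℕ := ((ℓ.1 0 - c).valMinAbs).natAbs

end Geometry

section Weight

variable {d L N : ℕ} {G : Type*} [Group G] [NeZero L] (ρ : G →* Matrix (Fin N) (Fin N) ℂ) (β : ℝ)

/-- The Boltzmann weight `exp(-β S_W(U))`. [folklore] -/
def bw (U : GaugeConfig d L G) : ℝ := Real.exp (-β * wilsonAction ρ U)

/-- Unfolding lemma for `bw`. [folklore] -/
theorem exp_eq_bw (U : GaugeConfig d L G) : Real.exp (-β * wilsonAction ρ U) = bw ρ β U := rfl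

end Weight

section Oscillation

variable {d L : ℕ} {G : Type*}

/-- The **oscillation** of `h` along the link `ℓ`: `osc h ℓ = sup_{U, g} |h(U[ℓ ↦ g]) − h(U)|`
(Martinelli 1999 §3, the seminorms `‖∇_ℓ h‖_∞`; a real supremum, meaningful for bounded `h`).
[folklore] -/
def osc (h : GaugeConfig d L G → ℝ) (ℓ : Edge d L) : ℝ :=
  ⨆ p : GaugeConfig d L G × G, |h (Function.update p.1 ℓ p.2) - h p.1|

end Oscillation

section HeatBath

variable {d L N : ℕ} {G : Type*} [Group G] [TopologicalSpace G] [IsTopologicalGroup G]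
  [CompactSpace G] [MeasurableSpace G] [BorelSpace G] [NeZero L]
  (ρ : G →* Matrix (Fin N) (Fin N) ℂ) (β : ℝ)

/-- The **one-link heat-bath law** of the link `ℓ` in the background `U`:
`ν_ℓ^U(dg) = Z_ℓ(U)⁻¹ exp(-β S_W(U[ℓ ↦ g])) dHaar(g)`, written as a tilted Haar probability
measure exactly as in the route's uniform Poincaré hypothesis (Martinelli 1999 §2.3, heat-bath
dynamics). [folklore] -/
def hbLaw (ℓ : Edge d L) (U : GaugeConfig d L G) : Measure G :=
  (haarProbability G).tilted fun g' => -β * wilsonAction ρ (Function.update U ℓ g')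

/-- The **heat-bath operator** of the link `ℓ`: `(E_ℓ h)(U) = ∫ h(U[ℓ ↦ g]) dν_ℓ^U(g)`
(resample the link `ℓ` from its conditional law) (Martinelli 1999 §2.3). [folklore] -/
def hbOp (ℓ : Edge d L) (h : GaugeConfig d L G → ℝ) (U : GaugeConfig d L G) : ℝ :=
  ∫ g, h (Function.update U ℓ g) ∂hbLaw ρ β ℓ U

/-- The **random-scan heat-bath operator** `K h = |E|⁻¹ ∑_ℓ E_ℓ h` of the torus Wilson theory
(one step of the discrete-time Glauber / Gibbs sampler with a uniformly chosen link)
(Martinelli 1999 §3). [folklore] -/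
def scanOp (h : GaugeConfig d L G → ℝ) (U : GaugeConfig d L G) : ℝ :=
  (Fintype.card (Edge d L) : ℝ)⁻¹ * ∑ ℓ, hbOp ρ β ℓ h U

/-- The iterates `K^j h` of the random-scan heat-bath operator. [folklore] -/
def scanIter (j : ℕ) (h : GaugeConfig d L G → ℝ) : GaugeConfig d L G → ℝ :=
  (scanOp ρ β)^[j] h

/-- `K^0 h = h`. [folklore] -/
theorem scanIter_zero (h : GaugeConfig d L G → ℝ) : scanIter ρ β 0 h = h := rfl

/-- `K^{j+1} h = K (K^j h)`. [folklore] -/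
theorem scanIter_succ (j : ℕ) (h : GaugeConfig d L G → ℝ) :
    scanIter ρ β (j + 1) h = scanOp ρ β (scanIter ρ β j h) :=
  Function.iterate_succ_apply' _ _ _

end HeatBath

end Summit.QuantumFields.YangMills.Theorems.PoincareClustering

end
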